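import Mathlib
import Summits.SmoothPoincare4.SmoothPoincare4.Theorems.HyperbolicEnd.Negative.LineGrowth
import Summits.SmoothPoincare4.SmoothPoincare4.Theorems.HyperbolicEnd.Negative.ExpWeightTest

/-!
# `HyperbolicEnd` (stmt-SmoothPoincare4-7825), line `Sketch`, negative side — neck not fillable

Helper for `Theorems/HyperbolicEnd/Negative/FrozenFill.lean` (frozen-`J` certificate filling
fails in complex dimension one). Statement registered on the crux item (stub
helper_neckNotFillable).

**Claim.** With `J` frozen to multiplication by `I` on `ℂ`, there is no density `F'` on the disc
`‖x‖ < 4` which agrees with the neck density `F(x, v) = (1 + 81/‖x‖⁴)‖v‖²` on the shell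
`2 < ‖x‖ < 4`, is positive definite, and is certified with some constant `c' > 0` (along every
local holomorphic curve `g` the density `λ = F'(g, ∂g)` is `C²` with `2c'λ³ ≤ λΔλ - |∇λ|²`).

**Proof (elementary maximum principle).** Pull back along `g = exp` on the half plane
`re w < log 4`: `Λ(w) = F'(eʷ)(eʷ)` is `C²`, `2πi`-periodic, positive, certified, equal to
`(1 + 81 e^{-4s}) e^{2s}` (`s = re w`) for `log 2 < s < log 4`, and bounded by
`16 e^{2s} / (c'(4 - e^s)²)` (growth bound along complex lines, `helper_lineGrowth`, file
`Negative/LineGrowth.lean`). The weighted density `Q = Λ e^{-s}` equals `6` on the line `s = log 3`,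
exceeds `6` at `s = log (29/10)`, and is `< 6` on the line `s = log (min 1 c' / 2)`. By compactness
and periodicity `Q` attains its maximum over the closed strip between these two lines at a point
of the open strip, i.e. at a local maximum in `ℂ`, contradicting the exponential-weight test (`helper_expWeightTest`,
file `Negative/ExpWeightTest.lean`: for a certified positive `λ`, `λ e^{-β s}` has no local
maximum).
-/

noncomputable section

-- the prescribed namespace `Summit.<P>.<Sub>.…` duplicates `SmoothPoincare4` (P = Sub)
set_option linter.dupNamespace false

open scoped ContDiff Topology Real
open Laplacian Set Filter Metric Complex

namespace Summit.SmoothPoincare4.SmoothPoincare4.Theorems.HyperbolicEnd.Negative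

/-! ### The exponential map as a holomorphic curve -/

/-- The real Fréchet derivative of `exp : ℂ → ℂ` is multiplication by `exp w`. -/
private theorem fderiv_real_cexp (w ζ : ℂ) :
    fderiv ℝ Complex.exp w ζ = Complex.exp w * ζ := by
  rw [(Complex.hasStrictFDerivAt_exp_real w).hasFDerivAt.fderiv]
  simp

/-! ### Values of the weighted density `Λ e^{-s}` on three vertical lines -/

/-- On the line `re z = log 3` the weighted neck density is `6`. -/
private theorem weighted_at_log_three {Λ : ℂ → ℝ}
    (hknown : ∀ z : ℂ, Real.log 2 < z.re → z.re < Real.log 4 →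
      Λ z = (1 + 81 / ((Real.exp z.re) ^ 2) ^ 2) * (Real.exp z.re) ^ 2)
    {z : ℂ} (hz : z.re = Real.log 3) : Λ z * Real.exp (-(1 * z.re)) = 6 := by
  have h2 : Real.log 2 < z.re := hz ▸ Real.log_lt_log (by norm_num) (by norm_num)
  have h4 : z.re < Real.log 4 := hz ▸ Real.log_lt_log (by norm_num) (by norm_num)
  rw [hknown z h2 h4, hz, one_mul, Real.exp_neg, Real.exp_log (by norm_num : (0 : ℝ) < 3)]
  norm_num

/-- At the real point `z = log (29/10)` the weighted neck density exceeds `6`. -/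
private theorem weighted_at_log_29 {Λ : ℂ → ℝ}
    (hknown : ∀ z : ℂ, Real.log 2 < z.re → z.re < Real.log 4 →
      Λ z = (1 + 81 / ((Real.exp z.re) ^ 2) ^ 2) * (Real.exp z.re) ^ 2) :
    6 < Λ (Real.log (29 / 10)) * Real.exp (-(1 * ((Real.log (29 / 10) : ℝ) : ℂ).re)) := by
  have hre : ((Real.log (29 / 10) : ℝ) : ℂ).re = Real.log (29 / 10) := Complex.ofReal_re _
  have h2 : Real.log 2 < ((Real.log (29 / 10) : ℝ) : ℂ).re :=
    hre ▸ Real.log_lt_log (by norm_num) (by norm_num)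
  have h4 : ((Real.log (29 / 10) : ℝ) : ℂ).re < Real.log 4 :=
    hre ▸ Real.log_lt_log (by norm_num) (by norm_num)
  rw [hknown _ h2 h4, hre, one_mul, Real.exp_neg,
    Real.exp_log (by norm_num : (0 : ℝ) < 29 / 10)]
  norm_num

/-- On the line `re z = log m`, `m = min 1 c' / 2`, the growth bound forces the weighted density
below `6`. -/
private theorem weighted_at_left {Λ : ℂ → ℝ} {c' : ℝ} (hc' : 0 < c')
    (hleft : ∀ z : ℂ, z.re < Real.log 4 →
      Λ z ≤ 16 * (Real.exp z.re) ^ 2 / (c' * (4 - Real.exp z.re) ^ 2))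
    {z : ℂ} (hz : z.re = Real.log (min 1 c' / 2)) : Λ z * Real.exp (-(1 * z.re)) < 6 := by
  set m : ℝ := min 1 c' / 2 with hm
  have hmin : 0 < min 1 c' := lt_min one_pos hc'
  have hm0 : 0 < m := by positivity
  have hm1 : m ≤ 1 / 2 := by
    have := min_le_left 1 c'
    rw [hm]; linarith
  have hmc : m ≤ c' / 2 := by
    have := min_le_right 1 c'
    rw [hm]; linarith
  have hexp : Real.exp z.re = m := by rw [hz, Real.exp_log hm0]
  have h4 : z.re < Real.log 4 := by
    rw [hz]
    exact Real.log_lt_log hm0 (by linarith)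
  have hΛ := hleft z h4
  rw [hexp] at hΛ
  rw [one_mul, Real.exp_neg, hexp]
  have h3 : 3 ≤ 4 - m := by linarith
  have hden : 0 < c' * (4 - m) ^ 2 := by positivity
  calc Λ z * m⁻¹ ≤ 16 * m ^ 2 / (c' * (4 - m) ^ 2) * m⁻¹ := by gcongr
    _ = 16 * m / (c' * (4 - m) ^ 2) := by
      field_simp
    _ < 6 := by
      rw [div_lt_iff₀ hden]
      nlinarith

/-! ### Periodic reduction to a compact rectangle -/

/-- A bound for a `2πi`-periodic function on the rectangle `[a, b] ×ℂ [0, 2π]` holds on the whole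
closed strip `a ≤ re z ≤ b`. -/
private theorem strip_le_of_rect_le {Q : ℂ → ℝ} (hQ : Function.Periodic Q (2 * π * I))
    {a b M : ℝ} (hK : ∀ z ∈ Icc a b ×ℂ Icc 0 (2 * π), Q z ≤ M) {z : ℂ} (ha : a ≤ z.re)
    (hb : z.re ≤ b) : Q z ≤ M := by
  obtain ⟨k, hk1, hk2⟩ : ∃ k : ℤ, (k : ℝ) * (2 * π) ≤ z.im ∧ z.im < ((k : ℝ) + 1) * (2 * π) := by
    refine ⟨⌊z.im / (2 * π)⌋, ?_, ?_⟩
    · have := Int.floor_le (z.im / (2 * π))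
      rwa [le_div_iff₀ Real.two_pi_pos] at this
    · have := Int.lt_floor_add_one (z.im / (2 * π))
      rwa [div_lt_iff₀ Real.two_pi_pos] at this
  rw [← hQ.sub_int_mul_eq k]
  apply hK
  rw [mem_reProdIm]
  constructor
  · have : (z - (k : ℂ) * (2 * π * I)).re = z.re := by simp
    rw [this]
    exact ⟨ha, hb⟩
  · have : (z - (k : ℂ) * (2 * π * I)).im = z.im - k * (2 * π) := by simp
    rw [this]
    constructor <;> nlinarith

/-! ### The maximum principle -/

/-- **No certified, positive, `2πi`-periodic density on the half plane `re w < log 4` matches the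
neck values on `log 2 < re w < log 4` and obeys the growth bound.** The weighted density
`Q = Λ e^{-re}` is maximised over the closed strip `log (min 1 c'/2) ≤ re ≤ log 3` (compactness of
one period rectangle plus periodicity); the two boundary lines carry values `< 6` and `= 6` while
`Q(log (29/10)) > 6`, so the maximum is a local maximum in `ℂ`, excluded by the exponential-weight
test. -/
private theorem no_density (Λ : ℂ → ℝ) (c' : ℝ) (hc' : 0 < c')
    (hC2 : ContDiffOn ℝ 2 Λ {w : ℂ | w.re < Real.log 4})
    (hineq : ∀ z ∈ {w : ℂ | w.re < Real.log 4}, 2 * c' * Λ z ^ 3 ≤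
      Λ z * (Δ Λ) z - ((fderiv ℝ Λ z 1) ^ 2 + (fderiv ℝ Λ z Complex.I) ^ 2))
    (hpos : ∀ z : ℂ, z.re < Real.log 4 → 0 < Λ z)
    (hper : Function.Periodic Λ (2 * π * I))
    (hknown : ∀ z : ℂ, Real.log 2 < z.re → z.re < Real.log 4 →
      Λ z = (1 + 81 / ((Real.exp z.re) ^ 2) ^ 2) * (Real.exp z.re) ^ 2)
    (hleft : ∀ z : ℂ, z.re < Real.log 4 →
      Λ z ≤ 16 * (Real.exp z.re) ^ 2 / (c' * (4 - Real.exp z.re) ^ 2)) : False := by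
  obtain ⟨Q, hQ⟩ : ∃ Q : ℂ → ℝ, Q = fun z => Λ z * Real.exp (-(1 * z.re)) := ⟨_, rfl⟩
  obtain ⟨s₀, hs₀⟩ : ∃ s : ℝ, s = Real.log (min 1 c' / 2) := ⟨_, rfl⟩
  have hm0 : 0 < min 1 c' / 2 := by
    have := lt_min one_pos hc'
    positivity
  have hs₀neg : s₀ < 0 :=
    hs₀ ▸ Real.log_neg hm0 (by have := min_le_left 1 c'; linarith)
  have h29pos : 0 < Real.log (29 / 10) := Real.log_pos (by norm_num)
  have h29le : Real.log (29 / 10) ≤ Real.log 3 := Real.log_le_log (by norm_num) (by norm_num)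
  have h34 : Real.log 3 < Real.log 4 := Real.log_lt_log (by norm_num) (by norm_num)
  have hU : IsOpen {w : ℂ | w.re < Real.log 4} := isOpen_lt Complex.continuous_re continuous_const
  -- one period of the closed strip
  obtain ⟨K, hK⟩ : ∃ K : Set ℂ, K = Icc s₀ (Real.log 3) ×ℂ Icc 0 (2 * π) := ⟨_, rfl⟩
  have hKc : IsCompact K := hK ▸ isCompact_Icc.reProdIm isCompact_Icc
  have hpK : ((Real.log (29 / 10) : ℝ) : ℂ) ∈ K := by
    rw [hK, mem_reProdIm, Complex.ofReal_re, Complex.ofReal_im]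
    exact ⟨⟨by linarith, h29le⟩, le_rfl, Real.two_pi_pos.le⟩
  have hKU : K ⊆ {w : ℂ | w.re < Real.log 4} := fun z hz => by
    rw [hK, mem_reProdIm] at hz
    exact lt_of_le_of_lt hz.1.2 h34
  have hQper : Function.Periodic Q (2 * π * I) := fun z => by
    have hre : (z + 2 * π * I).re = z.re := by simp
    simp only [hQ]
    rw [hper z, hre]
  have hQcont : ContinuousOn Q K := by
    rw [hQ]
    exact (hC2.continuousOn.mono hKU).mul (Continuous.continuousOn (by fun_prop))
  -- the maximum over one period, hence over the whole closed strip
  obtain ⟨w, hwK, hwmax⟩ := hKc.exists_isMaxOn ⟨_, hpK⟩ hQcont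
  rw [isMaxOn_iff] at hwmax
  have hstrip : ∀ z : ℂ, s₀ ≤ z.re → z.re ≤ Real.log 3 → Q z ≤ Q w := fun z ha hb =>
    strip_le_of_rect_le hQper (fun z hz => hwmax z (hK ▸ hz)) ha hb
  have h6 : 6 < Q (Real.log (29 / 10)) := by
    rw [hQ]
    exact weighted_at_log_29 hknown
  have hw29 : Q (Real.log (29 / 10)) ≤ Q w := hwmax _ hpK
  rw [hK, mem_reProdIm] at hwK
  obtain ⟨⟨hw1, hw2⟩, -⟩ := hwK
  rcases hw1.eq_or_lt with h1 | h1
  · -- the maximum sits on the far-left line, where `Q < 6`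
    have : Q w < 6 := by
      rw [hQ]
      exact weighted_at_left hc' hleft (h1.symm.trans hs₀)
    linarith
  rcases hw2.eq_or_lt with h2 | h2
  · -- the maximum sits on the line `re = log 3`, where `Q = 6`
    have : Q w = 6 := by
      rw [hQ]
      exact weighted_at_log_three hknown h2
    linarith
  -- interior point: a local maximum of `Λ e^{-re}` in `ℂ`, excluded by the weight test
  have hwU : w.re < Real.log 4 := lt_trans h2 h34
  have hV : IsOpen {z : ℂ | s₀ < z.re ∧ z.re < Real.log 3} :=
    (isOpen_lt continuous_const Complex.continuous_re).inter
      (isOpen_lt Complex.continuous_re continuous_const)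
  have hlocal : IsLocalMax Q w :=
    Filter.eventually_of_mem (hV.mem_nhds ⟨h1, h2⟩) fun z hz => hstrip z hz.1.le hz.2.le
  rw [hQ] at hlocal
  exact helper_expWeightTest Λ w 1 c' (hC2.contDiffAt (hU.mem_nhds hwU)) (hpos w hwU) hc'
    (hineq w hwU) hlocal

/-! ### The registered statement -/

/-- **The neck cannot be filled** (frozen `J = I`, complex dimension one). No density `F'` on the
disc `‖x‖ < 4` which equals the neck density `(1 + 81/‖x‖⁴)‖v‖²` on the shell `2 < ‖x‖ < 4` and is
positive definite can be certified with a constant `c' > 0`: pulling the certificate back along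
`exp` (a holomorphic curve into the disc on `re w < log 4`) produces a density excluded by
`no_density`. -/
theorem helper_neckNotFillable : ∀ (F' : ℂ → ℂ → ℝ) (c' : ℝ), 0 < c' → (∀ x ∈ Metric.ball (0 : ℂ) 4 \ Metric.closedBall (0 : ℂ) 2, ∀ v : ℂ, F' x v = (1 + 81 / (‖x‖ ^ 2) ^ 2) * ‖v‖ ^ 2) → (∀ x ∈ Metric.ball (0 : ℂ) 4, ∀ v : ℂ, 0 ≤ F' x v ∧ (F' x v = 0 → v = 0)) → (∀ (U : Set ℂ) (g : ℂ → ℂ), IsOpen U → ContDiffOn ℝ ∞ g U → (∀ z ∈ U, ∀ ζ : ℂ, fderiv ℝ g z (Complex.I * ζ) = Complex.I * fderiv ℝ g z ζ) → (∀ z ∈ U, g z ∈ Metric.ball (0 : ℂ) 4) → ContDiffOn ℝ 2 (fun w => F' (g w) (fderiv ℝ g w 1)) U ∧ ∀ z ∈ U, 2 * c' * (F' (g z) (fderiv ℝ g z 1)) ^ 3 ≤ F' (g z) (fderiv ℝ g z 1) * (Δ (fun w => F' (g w) (fderiv ℝ g w 1))) z - ((fderiv ℝ (fun w => F' (g w)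 (fderiv ℝ g w 1)) z 1) ^ 2 + (fderiv ℝ (fun w => F' (g w) (fderiv ℝ g w 1)) z Complex.I) ^ 2)) → False := by
  intro F' c' hc' hF hposF hcert
  have hU : IsOpen {w : ℂ | w.re < Real.log 4} := isOpen_lt Complex.continuous_re continuous_const
  have hball : ∀ w ∈ {w : ℂ | w.re < Real.log 4}, Complex.exp w ∈ Metric.ball (0 : ℂ) 4 := by
    intro w hw
    rw [mem_ball_zero_iff, Complex.norm_exp]
    calc Real.exp w.re < Real.exp (Real.log 4) := Real.exp_lt_exp.mpr hw
      _ = 4 := Real.exp_log (by norm_num)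
  -- pull the certificate back along the holomorphic curve `exp`
  obtain ⟨hC2, hineq⟩ := hcert {w : ℂ | w.re < Real.log 4} Complex.exp hU
    Complex.contDiff_exp.contDiffOn
    (fun z _ ζ => by rw [fderiv_real_cexp, fderiv_real_cexp]; ring) hball
  simp only [fderiv_real_cexp, mul_one] at hC2 hineq
  refine no_density (fun w => F' (Complex.exp w) (Complex.exp w)) c' hc' hC2 hineq ?_ ?_ ?_ ?_
  · -- positivity: `exp w ≠ 0` and `F'` is positive definite on the disc
    intro z hz
    have h := hposF (Complex.exp z) (hball z hz) (Complex.exp z)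
    exact lt_of_le_of_ne h.1 fun h0 => Complex.exp_ne_zero z (h.2 h0.symm)
  · -- periodicity of `exp`
    intro z
    show F' _ _ = F' _ _
    rw [Complex.exp_periodic z]
  · -- the known region `2 < ‖exp z‖ < 4`
    intro z h2 h4
    have hlt : 2 < ‖Complex.exp z‖ := by
      rw [Complex.norm_exp]
      calc (2 : ℝ) = Real.exp (Real.log 2) := (Real.exp_log (by norm_num)).symm
        _ < Real.exp z.re := Real.exp_lt_exp.mpr h2
    have hmem : Complex.exp z ∈ Metric.ball (0 : ℂ) 4 \ Metric.closedBall (0 : ℂ) 2 :=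
      ⟨hball z h4, fun h => (not_le.mpr hlt) (mem_closedBall_zero_iff.mp h)⟩
    show F' _ _ = _
    rw [hF _ hmem, Complex.norm_exp]
  · -- growth at the far left (growth bound along the complex line through `exp z`)
    intro z hz
    have h4 : ‖Complex.exp z‖ < 4 := mem_ball_zero_iff.mp (hball z hz)
    have h := helper_lineGrowth F' c' 4 (Complex.exp z) (Complex.exp z) hc' h4
      (Complex.exp_ne_zero z) hposF hcert
    show F' _ _ ≤ _
    rw [← Complex.norm_exp]
    exact h

end Summit.SmoothPoincare4.SmoothPoincare4.Theorems.HyperbolicEnd.Negative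

end
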